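import Literature.AlgebraicGeometry.Motives.AbelianVarietySquareOfGenericCube
import Literature.AlgebraicGeometry.Motives.ThickeningModel
import Literature.AlgebraicGeometry.Motives.TrivialLocusGenericSpread
import Literature.AlgebraicGeometry.Motives.AbelianVarietyTheoremOfCubeProofs
import Literature.RingTheory.RegularLocalRing.QuotientDVR
import HarnessLib

/-!
# From the closed point to the generic point of the base through discrete valuation rings:
# the trivial locus of a formally-liftable family climbs along generizations

Let `K` be a field, `P → Spec K` proper and geometrically integral, `T` an integral `K`-scheme
whose local rings are regular (e.g. smooth over `K`), and `D` a Cartier divisor on the integral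
scheme `P ×_K T`, with trivial locus `Z = Z(D) ⊆ T` (`CartierDivisor.trivialLocus`). Suppose

* (I) `𝒪(D)` is trivial along every infinitesimal neighbourhood
  `P ×_K Spec(𝒪_{T,t}/𝔪^{n+1}) → P ×_K T` of the fibre over every `t ∈ Z` — the output of Step (I)
  of Görtz–Wedhorn II, Lemma 24.72 (`CartierDivisor.TrivialAlong` along `thickeningPtι`,
  `Motives/TheoremOfCubeThickenings`; proved for the cube family in `Motives/CubeStepI`);
* (L) **DVR lifting**: for every discrete valuation ring `R` and every morphism `q : Spec R → T`,
  if `𝒪(D)` is trivial along `P ×_K Spec(R/𝔪_R^{n+1}) → P ×_K T` for all `n`, then it is trivial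
  along `P ×_K Spec R → P ×_K T` (a statement of "formal functions" type for `H⁰` over a DVR; it
  is kept as an explicit hypothesis `HL` of the theorems of this file and is proved elsewhere in
  this tree for smooth `P`, from the finiteness of `Ȟ¹` on a projective Chow cover of `P ⊗ R`).

Then (`CartierDivisor.genericPoint_mem_trivialLocus_of_mem`) **`Z ∋ t` implies `Z ∋ η_T`**: if
`t ≠ η_T`, the regular local ring `𝒪_{T,t}` has a prime `𝔭 ≠ 𝔪` with `R = 𝒪_{T,t}/𝔭` a DVR
(`Literature.RingTheory.RegularLocalRing.exists_isPrime_isDiscreteValuationRing_quotient`,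
Matsumura Thm. 14.2); the thickenings of `q : Spec R → Spec 𝒪_{T,t} → T` factor through those of
`t` (`exists_over_thickeningPt`), so (I) and (L) make `𝒪(D)` trivial along `P × Spec R`, hence on
the fibre over the image `t'` of the generic point of `Spec R` (`mem_trivialLocus_apply_of_trivialAlong_ptOverι`:
`q` is a preimmersion, so `κ(t') = Frac R`); `t'` is a proper generization of `t`, of smaller
codimension (`Order.coheight`), and induction on the codimension concludes.

Applied to the universal cube divisor of an abelian variety `A` over an algebraically closed field
(`AbelianVariety.cubeDivisor'`, `Motives/AbelianVarietySquareOfGenericCube`), where (I) is the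
theorem `theoremOfCube_trivialAlong_thickeningPt_holds` and `0 ∈ Z`, this gives
(`AbelianVariety.theoremOfTheSquare_of_dvrLifting`) **the theorem of the square for `A` from the
DVR lifting property (L) of the family `c(D)` on `(A × A) × A` alone** — through
`exists_isTrivialOver_of_genericPoint_mem_trivialLocus` (`Motives/TrivialLocusGenericSpread`) and
`theoremOfTheSquare_of_isTrivialOver_cubeDivisor'`. Neither the closedness of `Z` (seesaw,
Görtz–Wedhorn II, Thm. 24.66 (3)) nor the theorem on formal functions over the higher-dimensional
local rings `𝒪_{T,t}` is used. No named fact is introduced; (L) is a hypothesis, not a definition.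

Mathlib searched (pin): `Order.coheight`, `ringKrullDim_stalk_eq_coheight`, `le_iff_specializes`,
`Scheme.range_fromSpecStalk`, `Scheme.fromSpecStalk_closedPoint`,
`Scheme.Hom.SpecMap_residueFieldMap_fromSpecResidueField`, `Scheme.residue_residueFieldMap`,
`Ideal.quotientMap`, `IsClosedImmersion.spec_of_surjective` (used).

## References

* U. Görtz, T. Wedhorn, *Algebraic Geometry II: Cohomology of Schemes*, Springer Spektrum (2023),
  doi:10.1007/978-3-658-43031-3: Lemma 24.72 and its proof, Steps (I)–(II), pp. 548–549;
  Thm. 24.73, p. 550; Thm. 27.168, p. 878. [GortzWedhorn2023]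
* H. Matsumura, *Commutative Ring Theory*, CSAM 8 (1986): Thm. 14.2. [Matsumura1987]
* D. Mumford, *Abelian Varieties* (1970): §6, theorem of the cube and Cor. 4. [MumfordAV1970]
-/

universe u

open CategoryTheory CategoryTheory.Limits AlgebraicGeometry MonoidalCategory
open CartesianMonoidalCategory IsLocalRing
open scoped MonObj

noncomputable section

namespace Literature.AlgebraicGeometry.Motives

variable {K : Type u} [Field K]

/-! ### Points of `Spec R → T` lie in the trivial locus once `𝒪(D)` is trivial along `P × Spec R` -/

section PtOver

variable (P T : SchemeOver K) [GeometricallyIntegral P.hom] [IsIntegral (P ⊗ T).left]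

/-- A surjective map of local rings induces a bijection on residue fields; for a preimmersion
`q : Spec R → T` and `x ∈ Spec R` the residue field map `κ(q x) → κ(x)` is bijective. [folklore] -/
theorem residueFieldMap_bijective_of_isPreimmersion {R : CommRingCat.{u}} (q : Spec R ⟶ T.left)
    [IsPreimmersion q] (x : Spec R) : Function.Bijective (q.residueFieldMap x) := by
  refine ⟨(q.residueFieldMap x).hom.injective, fun y => ?_⟩
  have h : Function.Surjective (T.left.residue (q x) ≫ q.residueFieldMap x) := by
    rw [Scheme.residue_residueFieldMap]
    exact ((Spec R).residue_surjective x).comp (q.stalkMap_surjective x)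
  obtain ⟨a, ha⟩ := h y
  exact ⟨T.left.residue (q x) a, by simpa only [CommRingCat.comp_apply] using ha⟩

/-- **If `𝒪(D)` is trivial along `P ×_K Spec R → P ×_K T` for a preimmersion `q : Spec R → T`
(e.g. `Spec(𝒪_{T,t}/𝔭) → T`), then every point `q(x)` lies in the trivial locus `Z(D)`**: restrict
the trivialisation to the fibre `P × Spec κ(x)`, and identify `Spec κ(x) → T` with
`Spec κ(q x) → T` through the isomorphism `κ(q x) ≅ κ(x)`. [folklore] -/
theorem CartierDivisor.mem_trivialLocus_apply_of_trivialAlong_ptOverι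
    {D : CartierDivisor (P ⊗ T).left} {R : CommRingCat.{u}} (q : Spec R ⟶ T.left)
    [IsPreimmersion q] (h : D.TrivialAlong (P ◁ ptOverι T q).left) (x : Spec R) :
    q x ∈ CartierDivisor.trivialLocus P T D := by
  -- the fibre of `Spec R` at `x`, as a `K`-scheme over `T`
  let qx : Spec ((Spec R).residueField x) ⟶ T.left := (Spec R).fromSpecResidueField x ≫ q
  let rx : ptOver T qx ⟶ ptOver T q := Over.homMk ((Spec R).fromSpecResidueField x) rfl
  have hrx : rx ≫ ptOverι T q = ptOverι T qx := by ext : 1; rfl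
  have h1 : D.TrivialAlong (P ◁ ptOverι T qx).left := by
    have h' := h.comp (P ◁ rx).left
    rwa [← Over.comp_left, ← MonoidalCategory.whiskerLeft_comp, hrx] at h'
  -- `κ(q x) ≅ κ(x)`
  let e : T.left.residueField (q x) ≅ (Spec R).residueField x :=
    (RingEquiv.ofBijective _ (residueFieldMap_bijective_of_isPreimmersion T q x)).toCommRingCatIso
  have he : e.hom = q.residueFieldMap x := rfl
  have hqx : Spec.map e.hom ≫ T.left.fromSpecResidueField (q x) = qx := by
    rw [he, Scheme.Hom.SpecMap_residueFieldMap_fromSpecResidueField]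
  let sx : residuePt T (q x) ⟶ ptOver T qx :=
    Over.homMk (Spec.map e.inv) (by
      change Spec.map e.inv ≫ qx ≫ T.hom = T.left.fromSpecResidueField (q x) ≫ T.hom
      rw [← hqx, ← Category.assoc, ← Category.assoc, ← Spec.map_comp, Iso.hom_inv_id,
        Spec.map_id, Category.id_comp])
  have hsx : sx ≫ ptOverι T qx = residuePtι T (q x) := by
    ext : 1
    change Spec.map e.inv ≫ qx = T.left.fromSpecResidueField (q x)
    rw [← hqx, ← Category.assoc, ← Spec.map_comp, Iso.hom_inv_id, Spec.map_id, Category.id_comp]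
  have h2 : D.TrivialAlong (P ◁ residuePtι T (q x)).left := by
    have h' := h1.comp (P ◁ sx).left
    rwa [← Over.comp_left, ← MonoidalCategory.whiskerLeft_comp, hsx] at h'
  exact CartierDivisor.mem_trivialLocus_iff_trivialAlong.2 h2

end PtOver

/-! ### Thickenings of `Spec(𝒪_{T,t}/𝔭)` factor through those of `t` -/

section Thickenings

variable (T : SchemeOver K) (t : T.left) (p : Ideal (T.left.presheaf.stalk t))

/-- The ring `𝒪_{T,t}/𝔭` as an object of `CommRingCat`. [folklore] -/
abbrev stalkQuot : CommRingCat.{u} := CommRingCat.of (T.left.presheaf.stalk t ⧸ p)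

/-- The morphism `q : Spec(𝒪_{T,t}/𝔭) → Spec 𝒪_{T,t} → T`. [folklore] -/
abbrev specStalkQuotTo : Spec (stalkQuot T t p) ⟶ T.left :=
  Spec.map (CommRingCat.ofHom (Ideal.Quotient.mk p)) ≫ T.left.fromSpecStalk t

/-- `Spec(𝒪_{T,t}/𝔭) → T` is a preimmersion (a closed immersion followed by `Spec 𝒪_{T,t} → T`).
[folklore] -/
instance isPreimmersion_specStalkQuotTo : IsPreimmersion (specStalkQuotTo T t p) := by
  haveI : IsClosedImmersion (Spec.map (CommRingCat.ofHom (Ideal.Quotient.mk p)) :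
      Spec (stalkQuot T t p) ⟶ _) :=
    IsClosedImmersion.spec_of_surjective _ Ideal.Quotient.mk_surjective
  infer_instance

variable [IsLocalRing (T.left.presheaf.stalk t ⧸ p)]

/-- `𝔪_{𝒪_{T,t}}` is the preimage of the maximal ideal of the local ring `𝒪_{T,t}/𝔭`. [folklore] -/
theorem comap_maximalIdeal_stalkQuot :
    (maximalIdeal (T.left.presheaf.stalk t ⧸ p)).comap (Ideal.Quotient.mk p) =
      maximalIdeal (T.left.presheaf.stalk t) :=
  IsLocalRing.eq_maximalIdeal
    (Ideal.comap_isMaximal_of_surjective _ Ideal.Quotient.mk_surjective)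

/-- `𝔪^{n+1} ≤ (𝔪'^{n+1})` pulled back to `𝒪_{T,t}`. [folklore] -/
theorem pow_maximalIdeal_le_comap (n : ℕ) :
    maximalIdeal (T.left.presheaf.stalk t) ^ (n + 1) ≤
      (maximalIdeal (T.left.presheaf.stalk t ⧸ p) ^ (n + 1)).comap (Ideal.Quotient.mk p) := by
  rw [← Ideal.map_le_iff_le_comap, Ideal.map_pow]
  refine Ideal.pow_right_mono ?_ _
  rw [Ideal.map_le_iff_le_comap, comap_maximalIdeal_stalkQuot]

/-- The `n`-th thickening ring map `𝒪_{T,t}/𝔪^{n+1} → (𝒪_{T,t}/𝔭)/𝔪'^{n+1}` (`𝔪' = 𝔪/𝔭` the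
maximal ideal of the local ring `𝒪_{T,t}/𝔭`). [folklore] -/
def thickeningQuotMap (n : ℕ) :
    T.left.presheaf.stalk t ⧸ maximalIdeal (T.left.presheaf.stalk t) ^ (n + 1) →+*
      (T.left.presheaf.stalk t ⧸ p) ⧸ maximalIdeal (T.left.presheaf.stalk t ⧸ p) ^ (n + 1) :=
  Ideal.quotientMap _ (Ideal.Quotient.mk p) (pow_maximalIdeal_le_comap T t p n)

/-- `thickeningQuotMap ∘ (𝒪 → 𝒪/𝔪^{n+1}) = ((𝒪/𝔭) → (𝒪/𝔭)/𝔪'^{n+1}) ∘ (𝒪 → 𝒪/𝔭)`. [folklore] -/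
theorem thickeningQuotMap_comp_mk (n : ℕ) :
    (thickeningQuotMap T t p n).comp
        (Ideal.Quotient.mk (maximalIdeal (T.left.presheaf.stalk t) ^ (n + 1))) =
      (Ideal.Quotient.mk (maximalIdeal (T.left.presheaf.stalk t ⧸ p) ^ (n + 1))).comp
        (Ideal.Quotient.mk p) := by
  ext a; rfl

/-- The `n`-th thickening of `Spec(𝒪_{T,t}/𝔭)`: the morphism
`Spec((𝒪_{T,t}/𝔭)/𝔪'^{n+1}) → Spec(𝒪_{T,t}/𝔭) → T`. [folklore] -/
abbrev specStalkQuotThickTo (n : ℕ) : Spec (CommRingCat.of ((T.left.presheaf.stalk t ⧸ p) ⧸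
    maximalIdeal (T.left.presheaf.stalk t ⧸ p) ^ (n + 1))) ⟶ T.left :=
  Spec.map (CommRingCat.ofHom (Ideal.Quotient.mk
    (maximalIdeal (T.left.presheaf.stalk t ⧸ p) ^ (n + 1)))) ≫ specStalkQuotTo T t p

/-- **The thickenings of `Spec(𝒪_{T,t}/𝔭) → T` factor through the thickenings of `t`**: the
`K`-morphism `Spec((𝒪_{T,t}/𝔭)/𝔪'^{n+1}) → Spec(𝒪_{T,t}/𝔪^{n+1}) = thickeningPt T t n` over `T`.
[folklore] -/
def ptOverThickToThickeningPt (n : ℕ) :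
    ptOver T (specStalkQuotThickTo T t p n) ⟶ thickeningPt T t n :=
  Over.homMk (Spec.map (CommRingCat.ofHom (thickeningQuotMap T t p n))) (by
    change Spec.map _ ≫ Spec.map _ ≫ T.left.fromSpecStalk t ≫ T.hom =
      (Spec.map _ ≫ Spec.map _ ≫ T.left.fromSpecStalk t) ≫ T.hom
    simp only [Category.assoc, ← Spec.map_comp_assoc, ← CommRingCat.ofHom_comp,
      thickeningQuotMap_comp_mk])

/-- The factorisation is over `T`. [folklore] -/
theorem ptOverThickToThickeningPt_comp (n : ℕ) :
    ptOverThickToThickeningPt T t p n ≫ thickeningPtι T t n =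
      ptOverMap T (specStalkQuotTo T t p) (CommRingCat.ofHom (Ideal.Quotient.mk
        (maximalIdeal (T.left.presheaf.stalk t ⧸ p) ^ (n + 1)))) ≫
        ptOverι T (specStalkQuotTo T t p) := by
  ext : 1
  change Spec.map _ ≫ Spec.map _ ≫ T.left.fromSpecStalk t =
    Spec.map _ ≫ Spec.map _ ≫ T.left.fromSpecStalk t
  simp only [← Spec.map_comp_assoc, ← CommRingCat.ofHom_comp, thickeningQuotMap_comp_mk]

variable {T t p} in
/-- Triviality along the `n`-th infinitesimal neighbourhood of the fibre over `t` restricts to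
triviality along `P ×_K Spec((𝒪_{T,t}/𝔭)/𝔪'^{n+1})`. [folklore] -/
theorem CartierDivisor.TrivialAlong.ptOverThick {P : SchemeOver K} [IsIntegral (P ⊗ T).left]
    {D : CartierDivisor (P ⊗ T).left} {n : ℕ}
    (h : D.TrivialAlong (P ◁ thickeningPtι T t n).left) :
    D.TrivialAlong (P ◁ (ptOverMap T (specStalkQuotTo T t p)
      (CommRingCat.ofHom (Ideal.Quotient.mk (maximalIdeal (T.left.presheaf.stalk t ⧸ p) ^ (n + 1))))
        ≫ ptOverι T (specStalkQuotTo T t p))).left := by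
  have h' := h.comp (P ◁ ptOverThickToThickeningPt T t p n).left
  rwa [← Over.comp_left, ← MonoidalCategory.whiskerLeft_comp, ptOverThickToThickeningPt_comp] at h'

end Thickenings

/-! ### The descent along generizations -/

section Descent

variable (P T : SchemeOver K) [GeometricallyIntegral P.hom] [IsIntegral T.left]
  [IsIntegral (P ⊗ T).left]

/-- In the specialisation preorder of an integral scheme, a maximal point is the generic point.
[folklore] -/
theorem eq_genericPoint_of_isMax {t : T.left} (h : IsMax t) : t = genericPoint T.left := by
  have h1 : genericPoint T.left ≤ t := h (le_top (a := t))
  exact ((Scheme.le_iff_specializes.mp h1).antisymm (genericPoint_specializes t)).eq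

/-- A point of an integral scheme whose local ring has Krull dimension `0` is the generic point.
[folklore] -/
theorem eq_genericPoint_of_ringKrullDim_stalk_eq_zero {t : T.left}
    (h : ringKrullDim (T.left.presheaf.stalk t) = 0) : t = genericPoint T.left := by
  have hc : Order.coheight t = 0 := by
    have := ringKrullDim_stalk_eq_coheight t
    rw [h] at this
    exact_mod_cast this.symm
  exact eq_genericPoint_of_isMax T (Order.coheight_eq_zero.mp hc)

omit [IsIntegral T.left] in
/-- The image of the generic point of `Spec(𝒪_{T,t}/𝔭)` (the point `𝔭` of `Spec 𝒪_{T,t}`) is a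
proper generization of `t` when `𝔭 ≠ 𝔪`. [folklore] -/
theorem lt_specStalkQuotTo_apply (t : T.left) (p : Ideal (T.left.presheaf.stalk t))
    (hp : p ≠ maximalIdeal (T.left.presheaf.stalk t)) (x : Spec (stalkQuot T t p))
    (hx : x.asIdeal = ⊥) : t < specStalkQuotTo T t p x := by
  have hspec : specStalkQuotTo T t p x ⤳ t := by
    have : specStalkQuotTo T t p x ∈ Set.range (T.left.fromSpecStalk t) := ⟨_, rfl⟩
    rw [Scheme.range_fromSpecStalk] at this
    exact this
  refine lt_iff_le_not_ge.mpr ⟨Scheme.le_iff_specializes.mpr hspec, fun hle => ?_⟩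
  have heq : t = specStalkQuotTo T t p x :=
    ((Scheme.le_iff_specializes.mp hle).antisymm hspec).eq
  -- `fromSpecStalk` is injective and `t` is the image of the closed point
  have hinj : Function.Injective (T.left.fromSpecStalk t) :=
    (T.left.fromSpecStalk t).isEmbedding.injective
  have h1 : T.left.fromSpecStalk t (closedPoint (T.left.presheaf.stalk t)) =
      T.left.fromSpecStalk t (Spec.map (CommRingCat.ofHom (Ideal.Quotient.mk p)) x) := by
    rw [Scheme.fromSpecStalk_closedPoint]; exact heq
  have h2 := congrArg PrimeSpectrum.asIdeal (hinj h1)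
  -- the point `Spec(mk p) x` is `𝔭`
  have h3 : (Spec.map (CommRingCat.ofHom (Ideal.Quotient.mk p)) x).asIdeal = p := by
    change Ideal.comap (Ideal.Quotient.mk p) x.asIdeal = p
    rw [hx, ← RingHom.ker_eq_comap_bot, Ideal.mk_ker]
  apply hp
  rw [← h3, ← h2]
  rfl

variable {P T}

/-- **One step of the descent**: under (I) and the DVR lifting (L), a non-generic point `t` of the
trivial locus with regular local ring `𝒪_{T,t}` has a proper generization in the trivial locus —
the image of the generic point of `Spec(𝒪_{T,t}/𝔭)` for a prime `𝔭 ≠ 𝔪` with `𝒪_{T,t}/𝔭` a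
discrete valuation ring. [cite: Matsumura1987, Thm. 14.2] -/
theorem CartierDivisor.exists_lt_mem_trivialLocus {D : CartierDivisor (P ⊗ T).left}
    (HL : ∀ (R : CommRingCat.{u}) [IsDomain R] [IsDiscreteValuationRing R] (q : Spec R ⟶ T.left),
      (∀ n : ℕ, D.TrivialAlong (P ◁ (ptOverMap T q
        (CommRingCat.ofHom (Ideal.Quotient.mk (maximalIdeal R ^ (n + 1)))) ≫ ptOverι T q)).left) →
      D.TrivialAlong (P ◁ ptOverι T q).left)
    (HI : ∀ t ∈ CartierDivisor.trivialLocus P T D, ∀ n : ℕ,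
      D.TrivialAlong (P ◁ thickeningPtι T t n).left)
    {t : T.left} (hreg : IsRegularLocalRing (T.left.presheaf.stalk t))
    (ht : t ∈ CartierDivisor.trivialLocus P T D) (hne : t ≠ genericPoint T.left) :
    ∃ t' : T.left, t < t' ∧ t' ∈ CartierDivisor.trivialLocus P T D := by
  have hdim : ringKrullDim (T.left.presheaf.stalk t) ≠ 0 := fun h =>
    hne (eq_genericPoint_of_ringKrullDim_stalk_eq_zero T h)
  obtain ⟨p, hp, hdvr⟩ :=
    Literature.RingTheory.RegularLocalRing.exists_isPrime_isDiscreteValuationRing_quotient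
      (T.left.presheaf.stalk t) hdim
  haveI := hp
  have hpm : p ≠ maximalIdeal _ :=
    (Literature.RingTheory.RegularLocalRing.lt_maximalIdeal_of_isDiscreteValuationRing_quotient
      hdvr).ne
  haveI : IsDiscreteValuationRing (stalkQuot T t p) := hdvr
  -- (I) on the thickenings of `t`, restricted to those of `Spec(𝒪_{T,t}/𝔭)`, and (L)
  have h1 : D.TrivialAlong (P ◁ ptOverι T (specStalkQuotTo T t p)).left :=
    HL (stalkQuot T t p) (specStalkQuotTo T t p) fun n =>
      CartierDivisor.TrivialAlong.ptOverThick (HI t ht n)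
  let x : Spec (stalkQuot T t p) := ⟨⊥, Ideal.isPrime_bot⟩
  exact ⟨_, lt_specStalkQuotTo_apply T t p hpm x rfl,
    CartierDivisor.mem_trivialLocus_apply_of_trivialAlong_ptOverι P T _ h1 x⟩

/-- **The trivial locus climbs to the generic point** (the codimension descent): under (I), the
DVR lifting (L) and regularity of the local rings of `T`, if some `t ∈ Z(D)` then `η_T ∈ Z(D)`.
Induction on the codimension `coheight t = dim 𝒪_{T,t}`, which drops strictly along proper
generizations. [folklore] -/
theorem CartierDivisor.genericPoint_mem_trivialLocus_of_mem {D : CartierDivisor (P ⊗ T).left}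
    (HL : ∀ (R : CommRingCat.{u}) [IsDomain R] [IsDiscreteValuationRing R] (q : Spec R ⟶ T.left),
      (∀ n : ℕ, D.TrivialAlong (P ◁ (ptOverMap T q
        (CommRingCat.ofHom (Ideal.Quotient.mk (maximalIdeal R ^ (n + 1)))) ≫ ptOverι T q)).left) →
      D.TrivialAlong (P ◁ ptOverι T q).left)
    (HI : ∀ t ∈ CartierDivisor.trivialLocus P T D, ∀ n : ℕ,
      D.TrivialAlong (P ◁ thickeningPtι T t n).left)
    (hreg : ∀ t : T.left, IsRegularLocalRing (T.left.presheaf.stalk t))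
    {t : T.left} (ht : t ∈ CartierDivisor.trivialLocus P T D) :
    genericPoint T.left ∈ CartierDivisor.trivialLocus P T D := by
  -- codimensions are finite
  have hfin : ∀ s : T.left, Order.coheight s < ⊤ := by
    intro s
    haveI := hreg s
    obtain ⟨n, hn⟩ := Literature.AlgebraicGeometry.Resolution.exists_nat_cast_eq_ringKrullDim
      (R := T.left.presheaf.stalk s)
    rw [ringKrullDim_stalk_eq_coheight] at hn
    have : Order.coheight s = n := by exact_mod_cast hn
    rw [this]
    exact ENat.coe_lt_top n
  suffices H : ∀ (n : ℕ) (s : T.left), Order.coheight s ≤ n →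
      s ∈ CartierDivisor.trivialLocus P T D → genericPoint T.left ∈ CartierDivisor.trivialLocus P T D by
    obtain ⟨n, hn⟩ := ENat.ne_top_iff_exists.mp (hfin t).ne
    exact H n t hn.ge ht
  intro n
  induction n with
  | zero =>
    intro s hs hsZ
    have h0 : Order.coheight s = 0 := nonpos_iff_eq_zero.mp (by exact_mod_cast hs)
    rwa [eq_genericPoint_of_isMax T (Order.coheight_eq_zero.mp h0)] at hsZ
  | succ n ih =>
    intro s hs hsZ
    by_cases hgen : s = genericPoint T.left
    · rwa [hgen] at hsZ
    obtain ⟨s', hss', hs'Z⟩ := CartierDivisor.exists_lt_mem_trivialLocus HL HI (hreg s) hsZ hgen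
    refine ih s' ?_ hs'Z
    have hlt : Order.coheight s' < Order.coheight s := Order.coheight_strictAnti hss' (hfin s')
    have h2 : Order.coheight s' < (n : ℕ∞) + 1 := hlt.trans_le (by exact_mod_cast hs)
    exact (ENat.lt_add_one_iff (ENat.coe_ne_top n)).mp h2

end Descent

/-! ### The cube family of an abelian variety: the theorem of the square from DVR lifting -/

namespace AbelianVariety

variable (A : AbelianVariety K)

/-- The slice `{0} × A × A` of the universal cube divisor is trivial (the eight terms cancel in
pairs; Görtz–Wedhorn II, proof of Prop. 27.167). [cite: GortzWedhorn2023, Prop. 27.167, proof (p. 877)] -/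
theorem cubeDivisor_sliceLeft_linEquiv_zero (D : CartierDivisor A.X.left) :
    ((A.cubeDivisor D).classPullback
      ((λ_ (A.X ⊗ A.X)).inv ≫ η ▷ (A.X ⊗ A.X)).left).LinEquiv 0 := by
  unfold cubeDivisor
  apply classPullback_cubePos_add_neg_linEquiv_zero
  have e1 : ((λ_ (A.X ⊗ A.X)).inv ≫ η ▷ (A.X ⊗ A.X)) ≫
      CartesianMonoidalCategory.fst A.X (A.X ⊗ A.X) = 1 := by
    simp only [Category.assoc, whiskerRight_fst, leftUnitor_inv_fst_assoc]; rfl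
  have e2 : ((λ_ (A.X ⊗ A.X)).inv ≫ η ▷ (A.X ⊗ A.X)) ≫
      (CartesianMonoidalCategory.snd A.X (A.X ⊗ A.X) ≫ CartesianMonoidalCategory.fst A.X A.X) =
        CartesianMonoidalCategory.fst _ _ := by
    simp only [Category.assoc, whiskerRight_snd_assoc, leftUnitor_inv_snd_assoc]
  have e3 : ((λ_ (A.X ⊗ A.X)).inv ≫ η ▷ (A.X ⊗ A.X)) ≫
      (CartesianMonoidalCategory.snd A.X (A.X ⊗ A.X) ≫ CartesianMonoidalCategory.snd A.X A.X) =
        CartesianMonoidalCategory.snd _ _ := by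
    simp only [Category.assoc, whiskerRight_snd_assoc, leftUnitor_inv_snd_assoc]
  rw [e1, e2, e3]
  exact cubePos_one_left_linEquiv D _ _

/-- The slice `A × {0} × A` of the universal cube divisor is trivial.
[cite: GortzWedhorn2023, Prop. 27.167, proof (p. 877)] -/
theorem cubeDivisor_sliceMid_linEquiv_zero (D : CartierDivisor A.X.left) :
    ((A.cubeDivisor D).classPullback (A.X ◁ ((λ_ A.X).inv ≫ η ▷ A.X)).left).LinEquiv 0 := by
  unfold cubeDivisor
  apply classPullback_cubePos_add_neg_linEquiv_zero
  have e1 : (A.X ◁ ((λ_ A.X).inv ≫ η ▷ A.X)) ≫ CartesianMonoidalCategory.fst A.X (A.X ⊗ A.X) =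
      CartesianMonoidalCategory.fst _ _ := by
    simp only [whiskerLeft_fst]
  have e2 : (A.X ◁ ((λ_ A.X).inv ≫ η ▷ A.X)) ≫
      (CartesianMonoidalCategory.snd A.X (A.X ⊗ A.X) ≫ CartesianMonoidalCategory.fst A.X A.X) =
        1 := by
    simp only [whiskerLeft_snd_assoc, Category.assoc, whiskerRight_fst, leftUnitor_inv_fst_assoc]
    rw [Hom.one_def, ← Category.assoc, comp_toUnit]
  have e3 : (A.X ◁ ((λ_ A.X).inv ≫ η ▷ A.X)) ≫
      (CartesianMonoidalCategory.snd A.X (A.X ⊗ A.X) ≫ CartesianMonoidalCategory.snd A.X A.X) =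
        CartesianMonoidalCategory.snd _ _ := by
    simp only [whiskerLeft_snd_assoc, Category.assoc, whiskerRight_snd, leftUnitor_inv_snd,
      Category.comp_id]
  rw [e1, e2, e3]
  exact cubePos_one_mid_linEquiv D _ _

/-- The slice `A × A × {0}` of the universal cube divisor is trivial.
[cite: GortzWedhorn2023, Prop. 27.167, proof (p. 877)] -/
theorem cubeDivisor_sliceRight_linEquiv_zero (D : CartierDivisor A.X.left) :
    ((A.cubeDivisor D).classPullback (A.X ◁ ((ρ_ A.X).inv ≫ A.X ◁ η)).left).LinEquiv 0 := by
  unfold cubeDivisor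
  apply classPullback_cubePos_add_neg_linEquiv_zero
  have e1 : (A.X ◁ ((ρ_ A.X).inv ≫ A.X ◁ η)) ≫ CartesianMonoidalCategory.fst A.X (A.X ⊗ A.X) =
      CartesianMonoidalCategory.fst _ _ := by
    simp only [whiskerLeft_fst]
  have e2 : (A.X ◁ ((ρ_ A.X).inv ≫ A.X ◁ η)) ≫
      (CartesianMonoidalCategory.snd A.X (A.X ⊗ A.X) ≫ CartesianMonoidalCategory.fst A.X A.X) =
        CartesianMonoidalCategory.snd _ _ := by
    simp only [whiskerLeft_snd_assoc, Category.assoc, whiskerLeft_fst, rightUnitor_inv_fst,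
      Category.comp_id]
  have e3 : (A.X ◁ ((ρ_ A.X).inv ≫ A.X ◁ η)) ≫
      (CartesianMonoidalCategory.snd A.X (A.X ⊗ A.X) ≫ CartesianMonoidalCategory.snd A.X A.X) =
        1 := by
    simp only [whiskerLeft_snd_assoc, Category.assoc, whiskerLeft_snd, rightUnitor_inv_snd_assoc]
    rw [Hom.one_def, ← Category.assoc, comp_toUnit]
  rw [e1, e2, e3]
  exact cubePos_one_right_linEquiv D _ _

/-- The slice `{0} × A × A` of the transported cube divisor `c'(D)` on `(A × A) × A` is trivial
(the hypothesis `hx` of Görtz–Wedhorn II, Lemma 24.72 / `theoremOfCube_trivialAlong_thickeningPt`).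
[folklore] -/
theorem cubeDivisor'_sliceLeft_linEquiv_zero (D : CartierDivisor A.X.left) :
    ((A.cubeDivisor' D).classPullback (((λ_ A.X).inv ≫ η ▷ A.X) ▷ A.X).left).LinEquiv 0 := by
  refine ((A.cubeDivisor D).classPullback_comp_linEquiv (α_ A.X A.X A.X).hom.left _).symm.trans ?_
  rw [← Over.comp_left, whiskerRight_sliceLeft_comp_associator]
  exact A.cubeDivisor_sliceLeft_linEquiv_zero D

/-- The slice `A × {0} × A` of `c'(D)` is trivial (hypothesis `hy` of Lemma 24.72). [folklore] -/
theorem cubeDivisor'_sliceMid_linEquiv_zero (D : CartierDivisor A.X.left) :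
    ((A.cubeDivisor' D).classPullback (((ρ_ A.X).inv ≫ A.X ◁ η) ▷ A.X).left).LinEquiv 0 := by
  refine ((A.cubeDivisor D).classPullback_comp_linEquiv (α_ A.X A.X A.X).hom.left _).symm.trans ?_
  rw [← Over.comp_left, whiskerRight_sliceRight_comp_associator]
  exact A.cubeDivisor_sliceMid_linEquiv_zero D

/-- **The origin lies in the trivial locus of `c'(D)`** (the slice `A × A × {0}`). [folklore] -/
theorem origin_mem_trivialLocus_cubeDivisor' (D : CartierDivisor A.X.left)
    (s : (𝟙_ (SchemeOver K)).left) :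
    (η : 𝟙_ (SchemeOver K) ⟶ A.X).left s ∈
      CartierDivisor.trivialLocus (A.X ⊗ A.X) A.X (A.cubeDivisor' D) := by
  rw [CartierDivisor.mem_trivialLocus_iff]
  refine ((A.cubeDivisor D).classPullback_comp_linEquiv (α_ A.X A.X A.X).hom.left _).symm.trans ?_
  rw [← Over.comp_left, whiskerLeft_residuePtι_comp_associator, Over.comp_left]
  exact ((A.cubeDivisor D).classPullback_comp_linEquiv _ _).trans
    ((A.cubeDivisor_sliceRight_linEquiv_zero D).classPullback_zero _)

/-- **Step (I) for the cube family of an abelian variety**: `𝒪(c'(D))` is trivial along every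
infinitesimal neighbourhood of the fibre over every point of the trivial locus
(`theoremOfCube_trivialAlong_thickeningPt_holds`, `Motives/CubeStepI`; Görtz–Wedhorn II, Lemma 24.72,
proof, Step (I)). [cite: GortzWedhorn2023, Lemma 24.72, proof, Step (I) (p. 548)] -/
theorem trivialAlong_thickeningPt_cubeDivisor' (D : CartierDivisor A.X.left)
    {t : A.X.left} (ht : t ∈ CartierDivisor.trivialLocus (A.X ⊗ A.X) A.X (A.cubeDivisor' D))
    (n : ℕ) : (A.cubeDivisor' D).TrivialAlong ((A.X ⊗ A.X) ◁ thickeningPtι A.X t n).left :=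
  haveI : IsLocallyNoetherian A.X.left := LocallyOfFiniteType.isLocallyNoetherian A.X.hom
  theoremOfCube_trivialAlong_thickeningPt_holds K A.X A.X A.X η η (A.cubeDivisor' D)
    (A.cubeDivisor'_sliceLeft_linEquiv_zero D) (A.cubeDivisor'_sliceMid_linEquiv_zero D) t ht n

/-- **The generic point of the third factor lies in the trivial locus of `c'(D)`, granted the DVR
lifting property of the cube family** (the codimension descent
`CartierDivisor.genericPoint_mem_trivialLocus_of_mem`, started at the origin, with Step (I)
`trivialAlong_thickeningPt_cubeDivisor'` and the regularity of the local rings of `A`).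
[folklore] -/
theorem genericPoint_mem_trivialLocus_cubeDivisor' (D : CartierDivisor A.X.left)
    (HL : ∀ (R : CommRingCat.{u}) [IsDomain R] [IsDiscreteValuationRing R]
      (q : Spec R ⟶ A.X.left),
      (∀ n : ℕ, (A.cubeDivisor' D).TrivialAlong ((A.X ⊗ A.X) ◁ (ptOverMap A.X q
        (CommRingCat.ofHom (Ideal.Quotient.mk (maximalIdeal R ^ (n + 1)))) ≫ ptOverι A.X q)).left) →
      (A.cubeDivisor' D).TrivialAlong ((A.X ⊗ A.X) ◁ ptOverι A.X q).left) :
    genericPoint A.X.left ∈ CartierDivisor.trivialLocus (A.X ⊗ A.X) A.X (A.cubeDivisor' D) := by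
  obtain ⟨s⟩ : Nonempty (𝟙_ (SchemeOver K)).left := inferInstanceAs (Nonempty (Spec (.of K)))
  exact CartierDivisor.genericPoint_mem_trivialLocus_of_mem (P := A.X ⊗ A.X) (T := A.X) HL
    (fun t ht n => A.trivialAlong_thickeningPt_cubeDivisor' D ht n) A.isRegularLocalRing_stalk
    (A.origin_mem_trivialLocus_cubeDivisor' D s)

/-- **The theorem of the square for an abelian variety over an algebraically closed field, from the
DVR lifting property of its cube family** (Görtz–Wedhorn II, Thm. 27.168; Mumford §6, Cor. 4):
for every `D`, `η_A ∈ Z(c'(D))` (`genericPoint_mem_trivialLocus_cubeDivisor'`), so `c'(D)` is trivial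
over an open `U ∋ η_A` (`CartierDivisor.exists_isTrivialOver_of_genericPoint_mem_trivialLocus`,
`Motives/TrivialLocusGenericSpread`), and the square follows by the subgroup argument
(`theoremOfTheSquare_of_isTrivialOver_cubeDivisor'`, `Motives/AbelianVarietySquareOfGenericCube`).
[cite: GortzWedhorn2023, Thm. 27.168 (p. 878)] [cite: MumfordAV1970, §6 Cor. 4 (p. 59)] -/
theorem theoremOfTheSquare_of_dvrLifting [IsAlgClosed K]
    (HL : ∀ (D : CartierDivisor A.X.left) (R : CommRingCat.{u}) [IsDomain R]
      [IsDiscreteValuationRing R] (q : Spec R ⟶ A.X.left),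
      (∀ n : ℕ, (A.cubeDivisor' D).TrivialAlong ((A.X ⊗ A.X) ◁ (ptOverMap A.X q
        (CommRingCat.ofHom (Ideal.Quotient.mk (maximalIdeal R ^ (n + 1)))) ≫ ptOverι A.X q)).left) →
      (A.cubeDivisor' D).TrivialAlong ((A.X ⊗ A.X) ◁ ptOverι A.X q).left) :
    A.theoremOfTheSquare := by
  refine A.theoremOfTheSquare_of_isTrivialOver_cubeDivisor' fun D => ?_
  obtain ⟨U, hη, hU⟩ := CartierDivisor.exists_isTrivialOver_of_genericPoint_mem_trivialLocus
    (A.X ⊗ A.X) A.X (A.genericPoint_mem_trivialLocus_cubeDivisor' D (HL D))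
  exact ⟨U, ⟨_, hη⟩, hU⟩

end AbelianVariety

end Literature.AlgebraicGeometry.Motives

end
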